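import Summits.QuantumFields.BalabanUV.T4Continuum.Support.T4TrajectoryDensityGated

/-!
# `T4Continuum.NE1pFamilyBudget` — THE FAMILY FORMAT (F-fam) CARRIED THROUGH THE DRESSED BUDGET, booking level (spine estimate
# NE1′ (node O3b/H2), cell `pub-balaban`, sub-cell `t4`; tree target `Summits/QuantumFields/BalabanUV/T4Continuum/Support/`;
# ADDITIVE — imports `T4TrajectoryDensityGated` ONLY, modifies nothing)

AUTHORSHIP AND PROVENANCE.  Written by the NE1′ IDEATION seat t4-ne1p-p2, generation 29 (planner-b2b-balaban-t4-ne1p-p2-g29-0,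
2026-08-20), as the HOME-staged kernel scratch `t4/b2b-balaban-t4-ne1p-p2-g29/work/NE1pFamilyBudgetG29.Sketch.lean` (sha16
48f458f1bb357834, 555 l., farm rc 0 · 0 sorry; ideation seats do not file under `Summits/`).  COURIERED into the tree by the row
OWNER t4-ne1p-p1, generation 23 (prover-b2b-balaban-t4-ne1p-p1-g23-0), as the owner's FORMAT RULING on the synthesis wall's
consolidated ask (`t4/ideate/NE1p-WALL.md` §5: F-fam ∕ F-II″ ∕ F-fam-2): the family-indexed format IS ADMITTED into the row's
pipeline, and the history weight it cannot hide (`card_le_sumH`) is booked at the ROOT as the budget form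
(`Spine/NE1p/DressedRootFam.lean`).  Changes from the scratch: namespace `PubBalaban.T4.NE1pFamilyBudgetG29` →
`Summit.QuantumFields.BalabanUV.T4Continuum.NE1pFamilyBudget`, split into two modules at the 400-line limit (this = §1–§2 booking
level; `NE1pFamilyBudgetFn` = §3–§4 function level + readings), headers; declarations and proofs BYTE-IDENTICAL otherwise.

WHY (the ideation seat's finding, verbatim in substance).  Road P2's exit (ε) (oscillation-modulus tilt at MET steps) and every
«pay the history price» door of the wall deliver a background-Lipschitz ∕ modulus factor at a met step that depends on the met
COMPONENT `Y` of the family `b` — a per-step factor `α b k` that is FAMILY-dependent.  The tree's chain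
(`T4TrajectoryModulus.cont_of_contStepLawOn_dep`, `T4TrajectoryDensityPerFamily.cont_of_contStepLawOn_fam`,
`moduliAt_of_birth_cont_dep`, `transportsFromVar_of_moduliAt_dep`; `T4TrajectoryComparison.Trajectory.TransportsFromVar ∕
EnvBoundAtVar ∕ BirthsFromOld`; `T4TrajectoryDensityDressed.budgetGate ∕ budgetGate_of_envBound ∕ dressedBudget_closed`) takes ONE
rate `α k` ∕ `ρ k`, ONE birth constant `C` and ONE birth-scale class `σ j k` for every family.  This module types the
family-indexed format END TO END at booking level and shows what it costs:
* §1 `TransportsFromVarFam T C ρ` (`C : Birth → ℝ`, `ρ : Birth → ℕ → ℝ`), `RegeneratesFromVarFam`, `EnvBoundAtVarFam` ∕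
  `BirthsFromOldFam` with FAMILY classes `σ : Birth → ℕ → ℝ`; the tree shapes are the constant case (`…_const_iff`, all
  `Iff.rfl`); `envBoundAtVarFam_ranBelow_envGate` — the cumulative induction VERBATIM, pointwise in the family, with the class
  compatibility `(ρ b k + C b·c b k)·σ b k ≤ σ b (k+1)` PER FAMILY.
* §2 `budgetGateFam` (family envelopes in the component sum), `budgetGateFam_of_envBound` — the discharge goes through with family
  classes dominated by a HISTORY WEIGHT times the uniform two-rate class, `σ f k ≤ H f·A₀ρ₁^{k−j_f}τ^{K−j_f}`, PROVIDED the live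
  families of a component are counted WITH THEIR WEIGHTS: `Σ_{f ∈ S k b, j_f = j} H f ≤ N₀Λ^{k−j}` (`hcountH`);
  `dressedBudgetFam_closed` composes; an `example` recovers the tree theorem `dressedBudget_closed` at H ≡ 1 (consistency, not re-declared); `card_le_sumH` records that
  for `H ≥ 1` the weighted count is STRONGER than the plain positional count — THE BOOKING CANNOT HIDE HISTORY WEIGHTS: they are
  paid by whoever certifies `hcountH`, or kept out of the classes (paid at birth).

HONEST FRAMING.  Finite four-torus, rung (B)+1 only — NOT infinite volume, NOT a mass gap, NOT Clay, NOT summit progress.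
«continuum YM on T⁴ ⇐ BetaPertH ∧ nine spine estimates (0/9 proved); BetaPertH ⇐ (D1) ∧ (D4) ∧ CAP+tail; G-an2-4 gates asym,
D1 and NE2/3/4».  [folklore] arithmetic and induction cloned from the tree's own theorems (named below) with indices added;
0 sorry, 0 citations; nothing of Bałaban's densities or the cell's D-terms is asserted — every transport / regeneration / birth /
count / class statement stays a HYPOTHESIS about the cell's instantiation.
-/

namespace Summit.QuantumFields.BalabanUV.T4Continuum.NE1pFamilyBudget

open Finset
open Literature.MathematicalPhysics.QuantumFieldTheory.Balaban1983to89
open T4TermFormat T4TermFormat.Booking T4GatedBooking T4TrajectoryComparison T4TrajectoryComparison.Trajectory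
open T4TrajectoryModulus
open Summit.QuantumFields.BalabanUV.T4Continuum.T4TrajectoryDensityDressed

noncomputable section

/-! ## §1 Family-indexed transport data at booking level; the cumulative induction, pointwise in the family -/

section BookingLevel

variable {B : Booking} (T : Trajectory B)

/-- HYPOTHESIS SHAPE — k-step transport with a FAMILY birth constant `C b` and a FAMILY rate `ρ b i`:
`lin b k′ k ≤ C b·(∏_{[k′,k)} ρ b)·gen b k′` under the history.  The tree's `TransportsFromVar C ρ` is the constant case.
[folklore] -/
def TransportsFromVarFam (C : B.Birth → ℝ) (ρ : B.Birth → ℕ → ℝ) (Gate : ℕ → Prop) : Prop :=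
  ∀ (b : B.Birth) (k' k : ℕ), B.birthScale b ≤ k' → k' ≤ k → k ≤ B.K → RanBelow Gate k →
    T.lin b k' k ≤ C b * stepProd (ρ b) k' k * T.gen b k'

/-- HYPOTHESIS SHAPE — regeneration with a family-and-step constant `c b k`. [folklore] -/
def RegeneratesFromVarFam (c : B.Birth → ℕ → ℝ) (Gate : ℕ → Prop) : Prop :=
  ∀ (b : B.Birth) (k : ℕ), B.birthScale b ≤ k → k < B.K → RanBelow Gate (k + 1) →
    T.gen b (k + 1) ≤ c b k * B.size b k

/-- ENVELOPE BOUND AT SCALE `k` with FAMILY classes `σ b k` (the family's own envelope `envVar (C b) (ρ b) b k`, tree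
`Trajectory.envVar` BY NAME). [folklore] -/
def EnvBoundAtVarFam (C : B.Birth → ℝ) (ρ : B.Birth → ℕ → ℝ) (σ : B.Birth → ℕ → ℝ) (k : ℕ) : Prop :=
  ∀ b : B.Birth, B.birthScale b ≤ k → T.envVar (C b) (ρ b) b k ≤ σ b k

/-- HYPOTHESIS SHAPE — history-sourced births with family data: `C b·gen b j_b ≤ σ b j_b` provided the history below `j_b`
ran and every OLDER family's own envelope at `j_b` is within ITS class. [folklore] -/
def BirthsFromOldFam (C : B.Birth → ℝ) (ρ : B.Birth → ℕ → ℝ) (σ : B.Birth → ℕ → ℝ) (Gate : ℕ → Prop) : Prop :=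
  ∀ b : B.Birth, B.birthScale b ≤ B.K → RanBelow Gate (B.birthScale b) →
    (∀ b₀ : B.Birth, B.birthScale b₀ < B.birthScale b →
        T.envVar (C b₀) (ρ b₀) b₀ (B.birthScale b) ≤ σ b₀ (B.birthScale b)) →
    C b * T.gen b (B.birthScale b) ≤ σ b (B.birthScale b)

variable {T}

/-- CONSISTENCY — constant data IS the tree's `TransportsFromVar`. [folklore] -/
theorem transportsFromVarFam_const_iff {C : ℝ} {ρ : ℕ → ℝ} {Gate : ℕ → Prop} :
    TransportsFromVarFam T (fun _ => C) (fun _ => ρ) Gate ↔ T.TransportsFromVar C ρ Gate := Iff.rfl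

/-- CONSISTENCY — constant data IS the tree's `RegeneratesFromVar`. [folklore] -/
theorem regeneratesFromVarFam_const_iff {c : ℕ → ℝ} {Gate : ℕ → Prop} :
    RegeneratesFromVarFam T (fun _ => c) Gate ↔ T.RegeneratesFromVar c Gate := Iff.rfl

/-- CONSISTENCY — constant data and birth-scale classes IS the tree's `EnvBoundAtVar`. [folklore] -/
theorem envBoundAtVarFam_const_iff {C : ℝ} {ρ : ℕ → ℝ} {σ : ℕ → ℕ → ℝ} {k : ℕ} :
    EnvBoundAtVarFam T (fun _ => C) (fun _ => ρ) (fun b k => σ (B.birthScale b) k) k ↔ T.EnvBoundAtVar C ρ σ k :=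
  Iff.rfl

/-- CONSISTENCY — constant data and birth-scale classes IS the tree's `BirthsFromOld`. [folklore] -/
theorem birthsFromOldFam_const_iff {C : ℝ} {ρ : ℕ → ℝ} {σ : ℕ → ℕ → ℝ} {Gate : ℕ → Prop} :
    BirthsFromOldFam T (fun _ => C) (fun _ => ρ) (fun b k => σ (B.birthScale b) k) Gate ↔
      T.BirthsFromOld C ρ σ Gate := Iff.rfl

/-- ACTUAL SIZE ≤ THE FAMILY'S OWN ENVELOPE under the family transport and the history (tree `size_le_envVar`, pointwise).
[folklore] -/
theorem size_le_envVarFam {C : B.Birth → ℝ} {ρ : B.Birth → ℕ → ℝ} {Gate : ℕ → Prop}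
    (htr : TransportsFromVarFam T C ρ Gate) {b : B.Birth} {k : ℕ} (hbk : B.birthScale b ≤ k) (hk : k ≤ B.K)
    (hran : RanBelow Gate k) : B.size b k ≤ T.envVar (C b) (ρ b) b k :=
  (T.size_le b k hbk hk).trans
    (sum_le_sum fun k' hk' => htr b k' k (mem_Icc.1 hk').1 (mem_Icc.1 hk').2 hk hran)

/-- The birth case of the family envelope bound. [folklore] -/
theorem envVar_le_at_birthFam {C : B.Birth → ℝ} {ρ : B.Birth → ℕ → ℝ} {σ : B.Birth → ℕ → ℝ} {b : B.Birth} {k : ℕ}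
    (hk : B.birthScale b = k) (h : C b * T.gen b (B.birthScale b) ≤ σ b (B.birthScale b)) :
    T.envVar (C b) (ρ b) b k ≤ σ b k := by
  subst hk
  rw [envVar_birth]
  exact h

/-- **THE CUMULATIVE INDUCTION WITH FAMILY DATA AND AN ENVELOPE-DISCHARGED GATE** —
`T4TrajectoryDensityDressed.envBoundAtVar_ranBelow_envGate` VERBATIM with `C b`, `ρ b k`, `c b k`, `σ b k`: the proof was
pointwise in the family all along.  The ONE place where families were coupled — the class compatibility — is now asked PER
FAMILY: `(ρ b k + C b·c b k)·σ b k ≤ σ b (k+1)`. [folklore] -/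
theorem envBoundAtVarFam_ranBelow_envGate {C : B.Birth → ℝ} {ρ c σ : B.Birth → ℕ → ℝ} {Gate : ℕ → Prop}
    (hC : ∀ b, 0 ≤ C b) (hρ : ∀ b k, 0 ≤ ρ b k) (hc : ∀ b k, 0 ≤ c b k)
    (hbirth : BirthsFromOldFam T C ρ σ Gate)
    (hrate : ∀ b k, B.birthScale b ≤ k → k < B.K → (ρ b k + C b * c b k) * σ b k ≤ σ b (k + 1))
    (htr : TransportsFromVarFam T C ρ Gate) (hreg : RegeneratesFromVarFam T c Gate)
    (hgate : ∀ k, k < B.K → RanBelow Gate k → EnvBoundAtVarFam T C ρ σ k → Gate k) :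
    ∀ k, k ≤ B.K → EnvBoundAtVarFam T C ρ σ k ∧ RanBelow Gate k := by
  intro k
  induction k with
  | zero =>
    intro _
    refine ⟨fun b hb => ?_, ranBelow_zero Gate⟩
    have hb0 : B.birthScale b = 0 := Nat.le_zero.mp hb
    refine envVar_le_at_birthFam hb0 (hbirth b (hb.trans (Nat.zero_le _)) ?_ fun b₀ hb₀ => ?_)
    · rw [hb0]; exact ranBelow_zero Gate
    · rw [hb0] at hb₀; exact absurd hb₀ (Nat.not_lt_zero _)
  | succ k ih =>
    intro hk1
    have hk : k < B.K := Nat.lt_of_succ_le hk1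
    obtain ⟨henv, hran⟩ := ih hk.le
    have hran1 : RanBelow Gate (k + 1) := hran.succ (hgate k hk hran henv)
    have hold : ∀ b : B.Birth, B.birthScale b ≤ k → T.envVar (C b) (ρ b) b (k + 1) ≤ σ b (k + 1) := by
      intro b hbk
      rw [envVar_succ (C b) (ρ b) hbk]
      have h1 : T.envVar (C b) (ρ b) b k ≤ σ b k := henv b hbk
      have hsz : B.size b k ≤ σ b k := (size_le_envVarFam htr hbk hk.le hran).trans h1
      have h2 : T.gen b (k + 1) ≤ c b k * σ b k :=
        (hreg b k hbk hk hran1).trans (mul_le_mul_of_nonneg_left hsz (hc b k))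
      calc ρ b k * T.envVar (C b) (ρ b) b k + C b * T.gen b (k + 1)
          ≤ ρ b k * σ b k + C b * (c b k * σ b k) :=
            add_le_add (mul_le_mul_of_nonneg_left h1 (hρ b k)) (mul_le_mul_of_nonneg_left h2 (hC b))
        _ = (ρ b k + C b * c b k) * σ b k := by ring
        _ ≤ σ b (k + 1) := hrate b k hbk hk
    refine ⟨fun b hb => ?_, hran1⟩
    rcases Nat.lt_or_eq_of_le hb with hlt | heq
    · exact hold b (Nat.lt_succ_iff.mp hlt)
    · refine envVar_le_at_birthFam heq (hbirth b ?_ ?_ fun b₀ hb₀ => ?_)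
      · rw [heq]; exact hk1
      · rw [heq]; exact hran1
      · rw [heq] at hb₀ ⊢
        exact hold b₀ (Nat.lt_succ_iff.mp hb₀)

end BookingLevel

/-! ## §2 The dressed budget with family envelopes; its discharge needs the HISTORY-WEIGHTED count -/

section Gate

variable {B : Booking} {T : Trajectory B}

/-- **THE DRESSED BUDGET AT SCALE `k` WITH FAMILY ENVELOPES**: `s⁰ b k + m·Σ_{f ∈ S k b} envVar (C f) (ρ f) f k ≤ 1` for every
family alive at `k` (tree `budgetGate` is the constant case). [folklore] -/
def budgetGateFam (T : Trajectory B) (s₀ : B.Birth → ℕ → ℝ) (m : ℝ) (S : ℕ → B.Birth → Finset B.Birth)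
    (C : B.Birth → ℝ) (ρ : B.Birth → ℕ → ℝ) (k : ℕ) : Prop :=
  ∀ b : B.Birth, B.birthScale b ≤ k → s₀ b k + m * ∑ f ∈ S k b, T.envVar (C f) (ρ f) f k ≤ 1

/-- CONSISTENCY — constant data IS the tree's `budgetGate`. [folklore] -/
theorem budgetGateFam_const_iff {s₀ : B.Birth → ℕ → ℝ} {m C : ℝ} {S : ℕ → B.Birth → Finset B.Birth} {ρ : ℕ → ℝ}
    {k : ℕ} : budgetGateFam T s₀ m S (fun _ => C) (fun _ => ρ) k ↔ budgetGate T s₀ m S C ρ k := Iff.rfl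

/-- With the gate := the family budget, the gated capstone's `hs` binder IS the history (tree `hs_of_budgetGate`, verbatim).
[folklore] -/
theorem hs_of_budgetGateFam {s₀ : B.Birth → ℕ → ℝ} {m : ℝ} {C : B.Birth → ℝ} {S : ℕ → B.Birth → Finset B.Birth}
    {ρ : B.Birth → ℕ → ℝ} :
    ∀ (b : B.Birth) (k' k : ℕ), B.birthScale b ≤ k' → k' ≤ k → k + 1 ≤ B.K →
      RanBelow (budgetGateFam T s₀ m S C ρ) (k + 1) →
        s₀ b k + m * ∑ f ∈ S k b, T.envVar (C f) (ρ f) f k ≤ 1 :=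
  fun b _ k hbk' hk'k _ hran => hran k (Nat.lt_succ_self k) b (hbk'.trans hk'k)

/-- **THE FAMILY GATE FROM THE FAMILY ENVELOPE BOUND** — tree `budgetGate_of_envBound` with family classes dominated by a
HISTORY WEIGHT times the uniform two-rate class, `σ f k ≤ H f·(A₀ρ₁^{k−j_f}τ^{K−j_f})`, and the live families of every
component counted WITH THEIR WEIGHTS per birth scale: `Σ_{f ∈ S k b, j_f = j} H f ≤ N₀Λ^{k−j}`.  Same arithmetic
(`freshProfile_inner_le` BY NAME); the weighted count is the one new binder. [folklore] -/
theorem budgetGateFam_of_envBound {s₀ : B.Birth → ℕ → ℝ} {m : ℝ} {S : ℕ → B.Birth → Finset B.Birth}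
    {C H : B.Birth → ℝ} {ρ σ : B.Birth → ℕ → ℝ} {A₀ ρ₁ τ Λ N₀ ρ' sbar : ℝ} {k : ℕ}
    (hm : 0 ≤ m) (hA₀ : 0 ≤ A₀) (hρ₁ : 0 ≤ ρ₁) (hτ0 : 0 ≤ τ) (hτ1 : τ ≤ 1) (hΛ : 0 ≤ Λ) (hN₀ : 0 ≤ N₀)
    (hρ'1 : ρ' < 1) (hprod : Λ * ρ₁ * τ ≤ ρ') (hk : k ≤ B.K)
    (hS : ∀ b, ∀ f ∈ S k b, B.birthScale f ≤ k)
    (hcountH : ∀ b, ∀ j ≤ k, ∑ f ∈ (S k b).filter (fun f => B.birthScale f = j), H f ≤ N₀ * Λ ^ (k - j))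
    (hσ : ∀ f, B.birthScale f ≤ k →
      σ f k ≤ H f * (A₀ * ρ₁ ^ (k - B.birthScale f) * τ ^ (B.K - B.birthScale f)))
    (hs₀ : ∀ b, s₀ b k ≤ sbar) (hsmall : m * (N₀ * A₀ * (1 - ρ')⁻¹) ≤ 1 - sbar)
    (henv : EnvBoundAtVarFam T C ρ σ k) :
    budgetGateFam T s₀ m S C ρ k := by
  intro b _
  set g : ℕ → ℝ := fun j => A₀ * ρ₁ ^ (k - j) * τ ^ (B.K - j) with hg
  have hg0 : ∀ j, 0 ≤ g j := fun j => by rw [hg]; positivity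
  have hsum : ∑ f ∈ S k b, T.envVar (C f) (ρ f) f k ≤ N₀ * A₀ * (1 - ρ')⁻¹ := by
    have hregroup : ∑ f ∈ S k b, H f * g (B.birthScale f) =
        ∑ j ∈ range (k + 1), (∑ f ∈ (S k b).filter (fun f => B.birthScale f = j), H f) * g j := by
      classical
      rw [← sum_fiberwise_of_maps_to (s := S k b) (t := range (k + 1)) (g := B.birthScale)
        (fun f hf => mem_range_succ_iff.mpr (hS b f hf)) (fun f => H f * g (B.birthScale f))]
      refine sum_congr rfl fun j _ => ?_
      rw [sum_mul]
      refine sum_congr rfl fun f hf => ?_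
      rw [(mem_filter.mp hf).2]
    have hinner := freshProfile_inner_le (N₀ := N₀) (cδ := 1) (Ahat := A₀) (Λ := Λ) (φ := ρ₁) (τ := τ) (ρ := ρ')
      hN₀ zero_le_one hA₀ hΛ hρ₁ hτ0 hρ'1 hprod hk
    have hτpow : τ ^ (B.K - k) ≤ 1 := pow_le_one₀ hτ0 hτ1
    calc ∑ f ∈ S k b, T.envVar (C f) (ρ f) f k ≤ ∑ f ∈ S k b, H f * g (B.birthScale f) :=
          sum_le_sum fun f hf => (henv f (hS b f hf)).trans (by rw [hg]; exact hσ f (hS b f hf))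
      _ = ∑ j ∈ range (k + 1), (∑ f ∈ (S k b).filter (fun f => B.birthScale f = j), H f) * g j := hregroup
      _ ≤ ∑ j ∈ range (k + 1), N₀ * Λ ^ (k - j) * g j :=
          sum_le_sum fun j hj => mul_le_mul_of_nonneg_right (hcountH b j (mem_range_succ_iff.mp hj)) (hg0 j)
      _ = ∑ j ∈ range (k + 1), N₀ * Λ ^ (k - j) * (1 * ρ₁ ^ (k - j)) * (A₀ * τ ^ (B.K - j)) := by
          refine sum_congr rfl fun j _ => ?_
          rw [hg]
          ring
      _ ≤ N₀ * 1 * A₀ * (1 - ρ')⁻¹ * τ ^ (B.K - k) := hinner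
      _ ≤ N₀ * 1 * A₀ * (1 - ρ')⁻¹ * 1 := by
          refine mul_le_mul_of_nonneg_left hτpow ?_
          have : 0 ≤ (1 - ρ')⁻¹ := inv_nonneg.mpr (by linarith)
          positivity
      _ = N₀ * A₀ * (1 - ρ')⁻¹ := by ring
  calc s₀ b k + m * ∑ f ∈ S k b, T.envVar (C f) (ρ f) f k ≤ sbar + m * (N₀ * A₀ * (1 - ρ')⁻¹) :=
        add_le_add (hs₀ b) (mul_le_mul_of_nonneg_left hsum hm)
    _ ≤ 1 := by linarith

/-- UNIT WEIGHTS: the weighted count IS the tree's positional count (`card`). [folklore] -/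
theorem sumH_one_eq_card (S : Finset B.Birth) (j : ℕ) :
    ∑ _f ∈ S.filter (fun f => B.birthScale f = j), (1 : ℝ) = ((S.filter fun f => B.birthScale f = j).card : ℝ) := by
  rw [sum_const, nsmul_eq_mul, mul_one]

/-- **THE WEIGHTED COUNT IS STRONGER THAN THE PLAIN COUNT** as soon as every weight is `≥ 1` (a history prefactor is `≥ 1`):
the booking does not absorb the history weights — whoever certifies `hcountH` pays them. [folklore] -/
theorem card_le_sumH {H : B.Birth → ℝ} (hH : ∀ f, 1 ≤ H f) (S : Finset B.Birth) (j : ℕ) :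
    ((S.filter fun f => B.birthScale f = j).card : ℝ) ≤ ∑ f ∈ S.filter (fun f => B.birthScale f = j), H f := by
  rw [← sumH_one_eq_card]
  exact sum_le_sum fun f _ => hH f

/-- **EVERY FAMILY-DRESSED BUDGET ALONG THE TRAJECTORY** — tree `dressedBudget_closed` with family data: births from old (family
classes), PER-FAMILY class compatibility, family transport under the family gate, regeneration under the gate, family classes
dominated by `H f ×` the uniform two-rate class, the WEIGHTED positional count, strict product, action margin, K-FREE smallness
⟹ for every `k ≤ K`: the family envelope bound AND `RanBelow (budgetGateFam …) k`. [folklore] -/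
theorem dressedBudgetFam_closed {s₀ : B.Birth → ℕ → ℝ} {m : ℝ} {S : ℕ → B.Birth → Finset B.Birth}
    {C H : B.Birth → ℝ} {ρ c σ : B.Birth → ℕ → ℝ} {A₀ ρ₁ τ Λ N₀ ρ' sbar : ℝ}
    (hC : ∀ b, 0 ≤ C b) (hρ : ∀ b k, 0 ≤ ρ b k) (hc : ∀ b k, 0 ≤ c b k)
    (hm : 0 ≤ m) (hA₀ : 0 ≤ A₀) (hρ₁ : 0 ≤ ρ₁) (hτ0 : 0 ≤ τ) (hτ1 : τ ≤ 1) (hΛ : 0 ≤ Λ) (hN₀ : 0 ≤ N₀)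
    (hρ'1 : ρ' < 1) (hprod : Λ * ρ₁ * τ ≤ ρ')
    (hS : ∀ k b, ∀ f ∈ S k b, B.birthScale f ≤ k)
    (hcountH : ∀ k b, ∀ j ≤ k, ∑ f ∈ (S k b).filter (fun f => B.birthScale f = j), H f ≤ N₀ * Λ ^ (k - j))
    (hσ : ∀ f k, B.birthScale f ≤ k → k < B.K →
      σ f k ≤ H f * (A₀ * ρ₁ ^ (k - B.birthScale f) * τ ^ (B.K - B.birthScale f)))
    (hs₀ : ∀ b k, s₀ b k ≤ sbar) (hsmall : m * (N₀ * A₀ * (1 - ρ')⁻¹) ≤ 1 - sbar)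
    (hbirth : BirthsFromOldFam T C ρ σ (budgetGateFam T s₀ m S C ρ))
    (hrate : ∀ b k, B.birthScale b ≤ k → k < B.K → (ρ b k + C b * c b k) * σ b k ≤ σ b (k + 1))
    (htr : TransportsFromVarFam T C ρ (budgetGateFam T s₀ m S C ρ))
    (hreg : RegeneratesFromVarFam T c (budgetGateFam T s₀ m S C ρ)) :
    ∀ k, k ≤ B.K → EnvBoundAtVarFam T C ρ σ k ∧ RanBelow (budgetGateFam T s₀ m S C ρ) k :=
  envBoundAtVarFam_ranBelow_envGate hC hρ hc hbirth hrate htr hreg fun k hk _ henv =>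
    budgetGateFam_of_envBound hm hA₀ hρ₁ hτ0 hτ1 hΛ hN₀ hρ'1 hprod hk.le (hS k) (hcountH k)
      (fun f hf => hσ f k hf hk) (fun b => hs₀ b k) hsmall henv

/- CONSISTENCY (kept as an `example`: its TYPE is the landed tree theorem `T4TrajectoryDensityDressed.dressedBudget_closed`, which the gate's dedup lint forbids re-declaring under a new name — owner g23 courier note): CONSISTENCY — the tree's `dressedBudget_closed` IS the constant-data, unit-weight case of `dressedBudgetFam_closed`
(conclusion and gate literally the tree's, by `Iff.rfl` unfolding). [folklore] -/
example {s₀ : B.Birth → ℕ → ℝ} {m C : ℝ} {S : ℕ → B.Birth → Finset B.Birth} {ρ c : ℕ → ℝ}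
    {σ : ℕ → ℕ → ℝ} {A₀ ρ₁ τ Λ N₀ ρ' sbar : ℝ}
    (hC : 0 ≤ C) (hρ : ∀ k, 0 ≤ ρ k) (hc : ∀ k, 0 ≤ c k)
    (hm : 0 ≤ m) (hA₀ : 0 ≤ A₀) (hρ₁ : 0 ≤ ρ₁) (hτ0 : 0 ≤ τ) (hτ1 : τ ≤ 1) (hΛ : 0 ≤ Λ) (hN₀ : 0 ≤ N₀)
    (hρ'1 : ρ' < 1) (hprod : Λ * ρ₁ * τ ≤ ρ')
    (hS : ∀ k b, ∀ f ∈ S k b, B.birthScale f ≤ k)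
    (hcount : ∀ k b, ∀ j ≤ k, (((S k b).filter fun f => B.birthScale f = j).card : ℝ) ≤ N₀ * Λ ^ (k - j))
    (hσ : ∀ j k, j ≤ k → k < B.K → σ j k ≤ A₀ * ρ₁ ^ (k - j) * τ ^ (B.K - j))
    (hs₀ : ∀ b k, s₀ b k ≤ sbar) (hsmall : m * (N₀ * A₀ * (1 - ρ')⁻¹) ≤ 1 - sbar)
    (hbirth : T.BirthsFromOld C ρ σ (budgetGate T s₀ m S C ρ))
    (hrate : ∀ j k, j ≤ k → k < B.K → (ρ k + C * c k) * σ j k ≤ σ j (k + 1))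
    (htr : T.TransportsFromVar C ρ (budgetGate T s₀ m S C ρ))
    (hreg : T.RegeneratesFromVar c (budgetGate T s₀ m S C ρ)) :
    ∀ k, k ≤ B.K → T.EnvBoundAtVar C ρ σ k ∧ RanBelow (budgetGate T s₀ m S C ρ) k :=
  dressedBudgetFam_closed (T := T) (C := fun _ => C) (H := fun _ => 1) (ρ := fun _ => ρ) (c := fun _ => c)
    (σ := fun b k => σ (B.birthScale b) k)
    (fun _ => hC) (fun _ k => hρ k) (fun _ k => hc k) hm hA₀ hρ₁ hτ0 hτ1 hΛ hN₀ hρ'1 hprod hS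
    (fun k b j hj => by rw [sumH_one_eq_card]; exact hcount k b j hj)
    (fun f k hf hk => by rw [one_mul]; exact hσ _ k hf hk)
    hs₀ hsmall hbirth (fun b k hbk hk => hrate _ k hbk hk) htr hreg

end Gate

end

end Summit.QuantumFields.BalabanUV.T4Continuum.NE1pFamilyBudget
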